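import Literature.NumberTheory.GaloisRepresentations.TameInertiaGeneratorEvaluationProofs
import Literature.NumberTheory.GaloisRepresentations.FrobeniusQuotientHOne
import HarnessLib

/-!
# `H¹(I_F, A) ≃ A ⧸ (ρ τ − 1)A` by evaluation at a tame `p`-generator (theorems only)

Topic `NumberTheory/GaloisRepresentations`; namespace `Literature.NumberTheory.GaloisRepresentations`.
THEOREMS ONLY (no definition, no named fact, no `sorry`; D-0026). Cell `bsd-stepL`, K2 support 20495
(`JSWSigmaLocalCharIdeal`), step (S5) at the places of MULTIPLICATIVE reduction: sequel of
`TameInertiaGeneratorEvaluationProofs` (the unramified case `H¹(I_F, A) ≃ A`).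

Let `F` be a non-archimedean local field of residue characteristic `ℓ ≠ p`, `I_F = absInertia F`, and
`τ ∈ I_F` a **tame `p`-generator**: every continuous homomorphism of `I_F` into a discrete `p`-group has
image `⟨f τ⟩` (such `τ` exist, `exists_forall_continuousCohomology_absInertia_equiv_eval`; Greenberg–Vatsal:
"`I_ℓ` contains a unique subgroup `J_ℓ` … with `I_ℓ/J_ℓ ≅ ℤ_p(1)`; let `ε_ℓ` be a topological generator").
Let `ρ : Γ_F → Aut_{ℤ_p}(A)` be continuous on a discrete `p`-primary `A` with finite `A[p^k]`, such that every
`σ ∈ I_F` acts on `A` with pointwise `p`-power order (`∀ a, ∃ k, ρ(σ)^{p^k} a = a`; e.g. the unipotent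
inertia action on `E_q[p^∞]` of a Tate curve) — i.e. `I_F` acts on each `A[p^n]` through a finite `p`-group,
hence through the pro-`p` quotient `⟨τ⟩ ≅ ℤ_p(1)`. This file proves

* `exists_continuousCohomology_absInertia_equiv_coinvariants` — **`[z] ↦ z(τ) mod (ρ τ − 1)A` is a
  `ℤ_p`-linear bijection `H¹_cont(I_F, A) ≃ A ⧸ (ρ τ − 1)A`** (in the currency
  `continuousCohomology 1 (subgroupRep ρ.toTopRep (absInertia F)) ≃ₗ[ℤ_[p]] A ⧸ LinearMap.range (ρ τ − 1)`);
* `exists_tame_generator_continuousCohomology_absInertia` — one `τ` packaged with the generator property,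
  the unramified bijection `H¹ ≃ A` of the prequel, and the present one;
* `apply_sub_mem_range_sub_one`, `range_sub_one_le_comap`, `range_sub_one_eq_span` — `I_F` acts trivially
  on the `τ`-coinvariants `A ⧸ (ρ τ − 1)A`, which is the module of `I_F`-coinvariants `A_{I_F}`
  (`(ρ τ − 1)A = span{ρ(σ)a − a : σ ∈ I_F}`) and a `Γ_F/I_F`-module (`ρ(γ)` induces `Submodule.mapQ`;
  `hW` of the tree's `ContinuousRep.quotient`);
* `residueFieldCard_nsmul_equiv_conjMap_coinvariants` — **Frobenius: `q • ē(φ·c) = ρ̄(φ) ē(c)`** for the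
  conjugation action `conjMap` of a Frobenius `φ` ("`H¹(I_F, A) ≅ A_τ(−1)`"), from Serre §1.8 Prop. 6
  (`apply_conj_eq_pow_nsmul_of_isFrobPow`) applied to the continuous homomorphism `σ ↦ z(σ) mod (ρ τ − 1)A`.

This is "`H¹(Ī_ℓ, A_{J_ℓ}) = H¹(Ī_ℓ, A_{J_ℓ}/(ε_ℓ − 1)A_{J_ℓ})`" (Greenberg–Vatsal, proof of Prop. 2.4) /
"`H¹(Ẑ, A) = A/(F − 1)A`" (Serre, *Local Fields* XIII §1 Prop. 1) for the pro-`p` tame quotient of `I_F`.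

## Proof

Finite level throughout (`I_F` compact, `A` discrete): a continuous cocycle is killed by one `pⁿ`, and
`K = Fix(A[pⁿ]) ≤ I_F` is an open normal subgroup with `I_F/K` a finite `p`-group (`A[pⁿ]` finite,
pointwise `p`-power orders), so `I_F/K = ⟨τ̄⟩`. *Injectivity*: if `z(τ) = (ρ τ − 1)v` then `w = z − ∂v`
vanishes at `τ`, is a homomorphism on `K`, and is right-invariant under the open normal subgroup
`H = K ∩ ker w` with `I_F/H` a `p`-group, cyclic on `τ̄`; a cocycle inflated from a cyclic quotient is
determined by its value at the generator (`contOneCocycles.eq_zero_of_apply_eq_zero`), so `w = 0`.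
*Surjectivity*: for `a ∈ A[p^{n₀}]`, with `I_F/K = ⟨τ̄⟩` of order `p^s` and `H = K ∩ ker θ_{p^m}`,
`m = s + n₀` (`θ_{p^m}` the Kummer character of a uniformiser; its kernel is open, containing the stabiliser
of the chosen root, and it takes a primitive `p^m`-th root of unity, `exists_isPrimitiveRoot_kummerCharacter`),
the order `P` of `τ̄` in the `p`-group `I_F/H` is `p^s k` with `p^{n₀} ∣ k`, so the period sum
`Σ_{j<P} τʲ a = k • Σ_{j<p^s} τʲ a` vanishes and the geometric cocycle `σ ↦ Σ_{j<idx σ} τʲ a`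
(Serre XIII §1; the tree's `geomSum`/`idxQ`) is a continuous cocycle with value `a` at `τ`.

## References

* [GreenbergVatsal2000] R. Greenberg, V. Vatsal, *On the Iwasawa invariants of elliptic curves*, Invent.
  Math. 142 (2000), §2, proof of Prop. (2.4) (arXiv p. 22).
* [SerreLocalFields1979] J.-P. Serre, *Local Fields*, GTM 67, Ch. XIII §1 Prop. 1 (`H¹(Ẑ, A) = A/(F−1)A`).
* [SerreInventiones1972] J.-P. Serre, Invent. Math. 15 (1972), §1.3 Prop. 1 (`θ : I_t ≃ lim← μ_d`),
  §1.8 Prop. 6 (conjugation by a Frobenius acts on `I_t` by `u ↦ u^q`).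
-/

noncomputable section

open ValuativeRel Field
open scoped Pointwise Valued IntermediateField

namespace Literature.NumberTheory.GaloisRepresentations

open GaloisRepresentations.IsNonarchimedeanLocalField
open CategoryTheory
open _root_.TopRep _root_.ContinuousCohomology _root_.Topology

/-! ### The geometric cocycle of a cyclic quotient, with a local triviality hypothesis -/

section Geom

universe v w

variable {R : Type w} [CommRing R] [TopologicalSpace R]
variable {G : Type v} [Group G] [TopologicalSpace G] [IsTopologicalGroup G]
variable {X : TopRep.{v} R G}

omit [TopologicalSpace G] [IsTopologicalGroup G] in
/-- Torsion of the geometric sums: if `N • b₀ = 0` then `N • S(i) = 0`. [folklore] -/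
private theorem nsmul_geomSum_eq_zero (F : G) (b₀ : X) {N : ℕ} (hb : N • b₀ = 0) (i : ℕ) :
    N • geomSum F b₀ i = 0 := by
  induction i with
  | zero => rw [geomSum_zero, smul_zero]
  | succ i ih => rw [geomSum_succ, smul_add, ih, zero_add, ← map_nsmul, hb, map_zero]

omit [TopologicalSpace G] [IsTopologicalGroup G] in
/-- `S(a k) = k • S(a)` when `F ^ a` fixes all the geometric sums. [folklore] -/
private theorem geomSum_mul_eq_smul_of_forall (F : G) (b₀ : X) {a : ℕ}
    (ha : ∀ i, X.ρ (F ^ a) (geomSum F b₀ i) = geomSum F b₀ i) (k : ℕ) :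
    geomSum F b₀ (a * k) = k • geomSum F b₀ a := by
  have hak : ∀ (k i : ℕ), X.ρ (F ^ (a * k)) (geomSum F b₀ i) = geomSum F b₀ i := fun k => by
    induction k with
    | zero => intro i; rw [mul_zero, pow_zero, map_one]; rfl
    | succ k ih => intro i; rw [Nat.mul_succ, pow_add, ρ_mul_apply, ha, ih]
  induction k with
  | zero => rw [mul_zero, geomSum_zero, zero_smul]
  | succ k ih => rw [Nat.mul_succ, geomSum_add, ih, hak, succ_nsmul]

/-- **The geometric cocycle of a cyclic quotient, local form.** Let `H ⊴ G` be open with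
`G ⧸ H = ⟨F̄⟩`, and `b₀ ∈ X` such that `H` fixes all the sums `S(i) = Σ_{j<i} Fʲ b₀` and
`S(ord F̄) = 0`. Then `σ ↦ S(idx σ)` is a continuous crossed homomorphism `G → X` with value `b₀`
at `F` (the standard cocycle of the cyclic group `G/H` with prescribed value at the generator,
inflated to `G`; the tree's `geomCocycle` asks `H` to act trivially on all of `X`).
[cite: SerreLocalFields1979, XIII §1 Prop. 1] -/
private theorem exists_contOneCocycles_apply_eq_of_cyclic (F : G) (b₀ : X) (H : Subgroup G) [H.Normal]
    (hgen : ∀ q : G ⧸ H, ∃ i : ℕ, q = (QuotientGroup.mk F : G ⧸ H) ^ i)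
    (hopen : IsOpen (H : Set G))
    (hH : ∀ h ∈ H, ∀ i : ℕ, X.ρ h (geomSum F b₀ i) = geomSum F b₀ i)
    (hN : geomSum F b₀ (orderOf (QuotientGroup.mk F : G ⧸ H)) = 0) :
    ∃ z : contOneCocycles X, z.1 F = b₀ := by
  classical
  let f : G → X := fun σ => geomSum F b₀ (idxQ H F hgen (σ : G ⧸ H))
  have hfc : Continuous f := by
    haveI : DiscreteTopology (G ⧸ H) := QuotientGroup.discreteTopology hopen
    have hc : Continuous (fun q : G ⧸ H => geomSum F b₀ (idxQ H F hgen q)) :=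
      continuous_of_discreteTopology
    exact hc.comp QuotientGroup.continuous_mk
  refine ⟨⟨⟨f, hfc⟩, fun σ τ => ?_⟩, ?_⟩
  · change geomSum F b₀ (idxQ H F hgen ((σ * τ : G) : G ⧸ H)) =
      geomSum F b₀ (idxQ H F hgen (σ : G ⧸ H)) + X.ρ σ (geomSum F b₀ (idxQ H F hgen (τ : G ⧸ H)))
    rw [geomSum_eq_of_modEq F b₀ hN (idxQ_mul_modEq H F hgen σ τ), geomSum_add]
    congr 1
    have hh := pow_idxQ_inv_mul_mem H F hgen σ
    conv_rhs => rw [show σ = F ^ idxQ H F hgen (σ : G ⧸ H) * ((F ^ idxQ H F hgen (σ : G ⧸ H))⁻¹ * σ) by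
      rw [mul_inv_cancel_left]]
    rw [ρ_mul_apply, hH _ hh]
  · change geomSum F b₀ (idxQ H F hgen (F : G ⧸ H)) = b₀
    have h1 : idxQ H F hgen (F : G ⧸ H) ≡ 1 [MOD orderOf (QuotientGroup.mk F : G ⧸ H)] := by
      rw [← pow_eq_pow_iff_modEq, pow_one]
      exact (idxQ_spec H F hgen (F : G ⧸ H)).symm
    rw [geomSum_eq_of_modEq F b₀ hN h1, geomSum_one]

end Geom

/-! ### The open normal subgroups `Fix(A[pⁿ]) ≤ I_F` -/

section Compact

/-- A continuous map from a compact space to a discrete `p`-primary abelian group is killed by one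
power of `p`. [folklore] -/
private theorem exists_forall_pow_smul_apply_eq_zero' {G : Type*} [TopologicalSpace G] [CompactSpace G]
    {A : Type*} [AddCommGroup A] [TopologicalSpace A] [DiscreteTopology A] {p : ℕ}
    (hA : ∀ a : A, ∃ k : ℕ, p ^ k • a = 0) {f : G → A} (hf : Continuous f) :
    ∃ N : ℕ, ∀ g, p ^ N • f g = 0 := by
  choose k hk using hA
  obtain ⟨N, hN⟩ := ((isCompact_range hf).finite_of_discrete.image k).bddAbove
  refine ⟨N, fun g => ?_⟩
  have hle : k (f g) ≤ N := hN (Set.mem_image_of_mem k (Set.mem_range_self g))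
  rw [← Nat.sub_add_cancel hle, pow_add, mul_smul, hk, smul_zero]

end Compact

section Coinvariants

universe u

variable (F : Type u) [Field F] [ValuativeRel F] [TopologicalSpace F] [IsNonarchimedeanLocalField F]
variable {p : ℕ} [Fact p.Prime]
variable {A : Type u} [AddCommGroup A] [Module ℤ_[p] A] [TopologicalSpace A] [DiscreteTopology A]
  [ContinuousSMul ℤ_[p] A]

/-- A linear map fixing `a` has all its powers fixing `a`. [folklore] -/
private theorem pow_apply_eq_self_of_apply_eq_self {M : Type*} [AddCommGroup M] [Module ℤ_[p] M]
    (f : M →ₗ[ℤ_[p]] M) {a : M} (h : f a = a) (m : ℕ) : (f ^ m) a = a := by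
  induction m with
  | zero => rw [pow_zero, Module.End.one_apply]
  | succ m ih => rw [pow_succ, Module.End.mul_apply, h, ih]

omit [ContinuousSMul ℤ_[p] A] in
/-- **The pointwise stabiliser `Fix(A[pⁿ]) ≤ I_F` is an open normal subgroup, and `I_F / Fix(A[pⁿ])`
is a `p`-group** when `A[pⁿ]` is finite and every `σ ∈ I_F` acts on `A` with pointwise `p`-power
order. [folklore] -/
private theorem exists_openNormal_fixing (ρ : ContinuousRep (absoluteGaloisGroup F) ℤ_[p] A)
    (hfin : ∀ k : ℕ, Set.Finite {a : A | p ^ k • a = 0})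
    (hP : ∀ σ ∈ absInertia F, ∀ a : A, ∃ k : ℕ, ((ρ σ) ^ p ^ k) a = a) (n : ℕ) :
    ∃ K : Subgroup ↥(absInertia F), K.Normal ∧ IsOpen (K : Set ↥(absInertia F)) ∧
      (∀ g ∈ K, ∀ a : A, p ^ n • a = 0 → ρ (g : absoluteGaloisGroup F) a = a) ∧
      ∀ g : ↥(absInertia F), ∃ k : ℕ, g ^ p ^ k ∈ K := by
  classical
  -- torsion is preserved by the action
  have htors : ∀ (γ : absoluteGaloisGroup F) (a : A), p ^ n • a = 0 → p ^ n • ρ γ a = 0 :=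
    fun γ a ha => by rw [← map_nsmul, ha, map_zero]
  let K : Subgroup ↥(absInertia F) :=
    { carrier := ⋂ a ∈ {a : A | p ^ n • a = 0}, {g | ρ (g : absoluteGaloisGroup F) a = a}
      one_mem' := by
        simp only [Set.mem_iInter, Set.mem_setOf_eq, OneMemClass.coe_one, map_one, Module.End.one_apply,
          implies_true]
      mul_mem' := fun {g h} hg hh => by
        simp only [Set.mem_iInter, Set.mem_setOf_eq] at hg hh ⊢
        intro a ha
        rw [Subgroup.coe_mul, map_mul, Module.End.mul_apply, hh a ha, hg a ha]
      inv_mem' := fun {g} hg => by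
        simp only [Set.mem_iInter, Set.mem_setOf_eq] at hg ⊢
        intro a ha
        have h := hg a ha
        conv_lhs => rw [← h]
        rw [← Module.End.mul_apply, ← map_mul, Subgroup.coe_inv, inv_mul_cancel, map_one,
          Module.End.one_apply] }
  have hKmem : ∀ g : ↥(absInertia F), g ∈ K ↔ ∀ a : A, p ^ n • a = 0 → ρ (g : absoluteGaloisGroup F) a = a :=
    fun g => by
      change g ∈ (⋂ a ∈ {a : A | p ^ n • a = 0}, {g : ↥(absInertia F) | ρ (g : absoluteGaloisGroup F) a = a}) ↔ _
      simp only [Set.mem_iInter, Set.mem_setOf_eq]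
  have hKnormal : K.Normal := ⟨fun g hg σ => by
    rw [hKmem] at hg ⊢
    intro a ha
    rw [Subgroup.coe_mul, Subgroup.coe_mul, map_mul, map_mul, Module.End.mul_apply, Module.End.mul_apply,
      hg _ (htors _ a ha), ← Module.End.mul_apply, ← map_mul, Subgroup.coe_inv, mul_inv_cancel, map_one,
      Module.End.one_apply]⟩
  have hKopen : IsOpen (K : Set ↥(absInertia F)) := by
    change IsOpen (⋂ a ∈ {a : A | p ^ n • a = 0}, {g : ↥(absInertia F) | ρ (g : absoluteGaloisGroup F) a = a})
    refine (hfin n).isOpen_biInter fun a _ => ?_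
    exact (isOpen_discrete ({a} : Set A)).preimage
      ((ρ.continuous_apply_left a).comp continuous_subtype_val)
  refine ⟨K, hKnormal, hKopen, fun g hg => (hKmem g).1 hg, fun g => ?_⟩
  -- `g ^ (p ^ k) ∈ K` for the maximum `k` of the pointwise exponents on the finite `A[pⁿ]`
  choose k hk using fun a : A => hP g g.2 a
  obtain ⟨N, hN⟩ := ((hfin n).image k).bddAbove
  refine ⟨N, (hKmem _).2 fun a ha => ?_⟩
  have hle : k a ≤ N := hN (Set.mem_image_of_mem k ha)
  rw [Subgroup.coe_pow, map_pow, ← Nat.sub_add_cancel hle, pow_add, pow_mul']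
  exact pow_apply_eq_self_of_apply_eq_self _ (hk a) _

/-- **Injectivity of `[z] ↦ z(τ) mod (τ − 1)A`.** If `z(τ) = (ρ τ − 1)v` then `w = z − ∂v` vanishes at
`τ`; with `n` such that `pⁿ w = 0`, `K = Fix(A[pⁿ])` and `H = K ∩ ker w` (an open normal subgroup of
`I_F`: on `K` the cocycle `w` is a homomorphism into `A[pⁿ]`), the quotient `I_F / H` is a `p`-group,
hence cyclic on the image of the tame `p`-generator `τ`, and `w` is right-`H`-invariant, so `w = 0`
(`contOneCocycles.eq_zero_of_apply_eq_zero`) and `z = ∂v`. [cite: SerreLocalFields1979, XIII §1 Prop. 1] -/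
private theorem oneCocycleClass_eq_zero_of_apply_mem_range
    (ρ : ContinuousRep (absoluteGaloisGroup F) ℤ_[p] A)
    (hA : ∀ a : A, ∃ k : ℕ, p ^ k • a = 0) (hfin : ∀ k : ℕ, Set.Finite {a : A | p ^ k • a = 0})
    (hP : ∀ σ ∈ absInertia F, ∀ a : A, ∃ k : ℕ, ((ρ σ) ^ p ^ k) a = a)
    {τ : ↥(absInertia F)}
    (hτ : ∀ (B : Type u) [Group B] [TopologicalSpace B] [DiscreteTopology B], IsPGroup p B →
        ∀ f : ↥(absInertia F) →* B, Continuous f → f.range = Subgroup.zpowers (f τ))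
    (z : contOneCocycles (subgroupRep ρ.toTopRep (absInertia F)))
    (hz : (z.1 τ : A) ∈ LinearMap.range (ρ (τ : absoluteGaloisGroup F) - 1)) :
    oneCocycleClass _ z = 0 := by
  classical
  haveI : CompactSpace (absoluteGaloisGroup F) := absoluteGaloisGroup_compactSpace F
  haveI : CompactSpace (absInertia F) :=
    isCompact_iff_compactSpace.mp (isClosed_absInertia_holds F).isCompact
  revert z
  set X := subgroupRep ρ.toTopRep (absInertia F) with hXdef
  intro z hz
  have hXρ : ∀ (g : ↥(absInertia F)) (x : A), X.ρ g x = ρ (g : absoluteGaloisGroup F) x :=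
    fun _ _ => rfl
  obtain ⟨v, hv⟩ := hz
  -- the coboundary `∂v`
  let dv : contOneCocycles X :=
    ⟨⟨fun g => ρ (g : absoluteGaloisGroup F) v - v,
      ((ρ.continuous_apply_left v).comp continuous_subtype_val).sub continuous_const⟩, fun g h => by
      change ρ ((g * h : ↥(absInertia F)) : absoluteGaloisGroup F) v - v =
        (ρ (g : absoluteGaloisGroup F) v - v) + X.ρ g (ρ (h : absoluteGaloisGroup F) v - v)
      rw [hXρ, Subgroup.coe_mul, map_mul, Module.End.mul_apply, map_sub]
      abel⟩
  set w : contOneCocycles X := z - dv with hwdef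
  have hwapply : ∀ g, w.1 g = z.1 g - (ρ (g : absoluteGaloisGroup F) v - v) := fun _ => rfl
  have hwτ : w.1 τ = 0 := by
    rw [hwapply, ← hv, LinearMap.sub_apply, Module.End.one_apply, sub_self]
  -- a uniform exponent for the values of `w`, and `K = Fix(A[pⁿ])`
  obtain ⟨n, hn⟩ := exists_forall_pow_smul_apply_eq_zero' (A := A) hA (f := fun g => (w.1 g : A))
    w.1.continuous
  obtain ⟨K, hKn, hKo, hKfix, hKpow⟩ := exists_openNormal_fixing F ρ hfin hP n
  haveI := hKn
  have hKw : ∀ k ∈ K, ∀ g, X.ρ k (w.1 g) = w.1 g := fun k hk g => by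
    rw [hXρ]; exact hKfix k hk _ (hn g)
  -- on `K`, `w` is a homomorphism
  have hwK : ∀ k ∈ K, ∀ m : ℕ, (w.1 (k ^ m) : A) = m • (w.1 k : A) := fun k hk m => by
    induction m with
    | zero => rw [pow_zero, zero_smul]; exact contOneCocycles.apply_one w
    | succ m ih => rw [pow_succ, w.2, ih, hKw _ (K.pow_mem hk m), succ_nsmul]
  -- the subgroup `H = K ∩ ker w`
  let H : Subgroup ↥(absInertia F) :=
    { carrier := (K : Set ↥(absInertia F)) ∩ (fun g => (w.1 g : A)) ⁻¹' {0}
      one_mem' := ⟨K.one_mem, contOneCocycles.apply_one w⟩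
      mul_mem' := fun {g h} hg hh => ⟨K.mul_mem hg.1 hh.1, by
        have hg0 : w.1 g = 0 := hg.2
        have hh0 : w.1 h = 0 := hh.2
        change w.1 (g * h) = 0
        rw [w.2, hh0, map_zero, add_zero, hg0]⟩
      inv_mem' := fun {g} hg => ⟨K.inv_mem hg.1, by
        have hg0 : w.1 g = 0 := hg.2
        change w.1 g⁻¹ = 0
        have h := w.2 g⁻¹ g
        rw [inv_mul_cancel, contOneCocycles.apply_one, hg0, map_zero, add_zero] at h
        exact h.symm⟩ }
  have hHmem : ∀ g, g ∈ H ↔ g ∈ K ∧ w.1 g = 0 := fun g => Iff.rfl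
  haveI hHn : H.Normal := ⟨fun h hh σ => by
    rw [hHmem] at hh ⊢
    refine ⟨hKn.conj_mem h hh.1 σ, ?_⟩
    have h1 : w.1 (h * σ⁻¹) = w.1 σ⁻¹ := by
      rw [w.2, hh.2, zero_add, hKw h hh.1]
    have h2 : w.1 (σ * (h * σ⁻¹)) = w.1 (σ * σ⁻¹) := by
      rw [w.2, h1, ← w.2]
    rw [mul_assoc, h2, mul_inv_cancel, contOneCocycles.apply_one]⟩
  have hHo : IsOpen (H : Set ↥(absInertia F)) :=
    hKo.inter ((isOpen_discrete ({0} : Set A)).preimage w.1.continuous)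
  -- `I_F / H` is a finite `p`-group, generated by the image of `τ`
  haveI : DiscreteTopology (↥(absInertia F) ⧸ H) := QuotientGroup.discreteTopology hHo
  haveI : Finite (↥(absInertia F) ⧸ H) := Subgroup.quotient_finite_of_isOpen H hHo
  have hPgrp : IsPGroup p (↥(absInertia F) ⧸ H) := by
    intro q
    obtain ⟨g, rfl⟩ := QuotientGroup.mk_surjective q
    obtain ⟨k, hk⟩ := hKpow g
    refine ⟨k + n, ?_⟩
    rw [← QuotientGroup.mk_pow, QuotientGroup.eq_one_iff, pow_add, pow_mul, hHmem]
    refine ⟨K.pow_mem hk _, ?_⟩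
    have h := hwK _ hk (p ^ n)
    rw [hn] at h
    exact h
  have hgen : ∀ q : ↥(absInertia F) ⧸ H, ∃ i : ℕ, q = (QuotientGroup.mk τ : ↥(absInertia F) ⧸ H) ^ i := by
    intro q
    have hrange := hτ (↥(absInertia F) ⧸ H) hPgrp (QuotientGroup.mk' H)
      (by exact QuotientGroup.continuous_mk)
    have hq : q ∈ Subgroup.zpowers (QuotientGroup.mk' H τ) := by
      rw [← hrange, QuotientGroup.range_mk']; exact Subgroup.mem_top q
    rw [← (isOfFinOrder_of_finite _).mem_powers_iff_mem_zpowers, Submonoid.mem_powers_iff] at hq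
    obtain ⟨i, hi⟩ := hq
    exact ⟨i, hi.symm⟩
  -- conclusion: `w = 0`, so `z = ∂v` is a coboundary
  have hw' : ∀ σ, ∀ h ∈ H, w.1 (σ * h) = w.1 σ := fun σ h hh => by
    rw [w.2, ((hHmem h).1 hh).2, map_zero, add_zero]
  have hw0 : w = 0 := contOneCocycles.eq_zero_of_apply_eq_zero τ H hgen w hw' hwτ
  refine (oneCocycleClass_eq_zero_iff X z).2 ⟨v, fun g => ?_⟩
  have h := hwapply g
  rw [hw0, ZeroMemClass.coe_zero, ContinuousMap.zero_apply, eq_comm, sub_eq_zero] at h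
  rw [hXρ]
  exact h

/-- **Surjectivity of `[z] ↦ z(τ)`: the geometric cocycle.** For `a ∈ A[p^{n₀}]` let `K = Fix(A[p^{n₀}])`
(`I_F/K = ⟨τ̄⟩` of order `p^s`) and `H = K ∩ ker θ_{p^m}`, `m = s + n₀`, with `θ_{p^m}` the Kummer character
of a uniformiser (`ker θ_{p^m}` is open: it contains the stabiliser of the chosen root). Then `I_F / H` is
a `p`-group, cyclic on `τ̄` of order `P = p^s k` with `p^{n₀} ∣ k` (`θ_{p^m}` takes a primitive `p^m`-th
root of unity, `exists_isPrimitiveRoot_kummerCharacter`), so the period sum `Σ_{j<P} τʲ a = k • Σ_{j<p^s} τʲ a`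
vanishes and the geometric cocycle `σ ↦ Σ_{j<idx σ} τʲ a` is defined, with value `a` at `τ`.
[cite: SerreLocalFields1979, XIII §1 Prop. 1] [cite: SerreInventiones1972, §1.3 Prop. 1] -/
private theorem exists_contOneCocycles_absInertia_apply_eq
    (ρ : ContinuousRep (absoluteGaloisGroup F) ℤ_[p] A) (hℓ : ringChar 𝓀[F] ≠ p)
    (hA : ∀ a : A, ∃ k : ℕ, p ^ k • a = 0) (hfin : ∀ k : ℕ, Set.Finite {a : A | p ^ k • a = 0})
    (hP : ∀ σ ∈ absInertia F, ∀ a : A, ∃ k : ℕ, ((ρ σ) ^ p ^ k) a = a)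
    {τ : ↥(absInertia F)}
    (hτ : ∀ (B : Type u) [Group B] [TopologicalSpace B] [DiscreteTopology B], IsPGroup p B →
        ∀ f : ↥(absInertia F) →* B, Continuous f → f.range = Subgroup.zpowers (f τ))
    (a : A) :
    ∃ z : contOneCocycles (subgroupRep ρ.toTopRep (absInertia F)), (z.1 τ : A) = a := by
  classical
  haveI : CompactSpace (absoluteGaloisGroup F) := absoluteGaloisGroup_compactSpace F
  haveI : CompactSpace (absInertia F) :=
    isCompact_iff_compactSpace.mp (isClosed_absInertia_holds F).isCompact
  set X := subgroupRep ρ.toTopRep (absInertia F) with hXdef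
  have hXρ : ∀ (g : ↥(absInertia F)) (x : A), X.ρ g x = ρ (g : absoluteGaloisGroup F) x :=
    fun _ _ => rfl
  have hp : p.Prime := Fact.out
  obtain ⟨n₀, hn₀⟩ := hA a
  obtain ⟨K, hKn, hKo, hKfix, hKpow⟩ := exists_openNormal_fixing F ρ hfin hP n₀
  haveI := hKn
  -- the geometric sums `S(i) = Σ_{j<i} τʲ a` lie in `A[p^{n₀}]`, hence are fixed by `K`
  have hS : ∀ i, p ^ n₀ • (geomSum (X := X) τ a i : A) = 0 := fun i =>
    nsmul_geomSum_eq_zero (X := X) τ a hn₀ i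
  have hKS : ∀ k ∈ K, ∀ i, X.ρ k (geomSum (X := X) τ a i) = geomSum (X := X) τ a i :=
    fun k hk i => by rw [hXρ]; exact hKfix k hk _ (hS i)
  -- `I_F / K` is a finite `p`-group; `τ̄` has order `n₁ = p^s` in it
  haveI : DiscreteTopology (↥(absInertia F) ⧸ K) := QuotientGroup.discreteTopology hKo
  haveI : Finite (↥(absInertia F) ⧸ K) := Subgroup.quotient_finite_of_isOpen K hKo
  have hPK : IsPGroup p (↥(absInertia F) ⧸ K) := fun q => by
    obtain ⟨g, rfl⟩ := QuotientGroup.mk_surjective q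
    obtain ⟨k, hk⟩ := hKpow g
    exact ⟨k, by rw [← QuotientGroup.mk_pow, QuotientGroup.eq_one_iff]; exact hk⟩
  obtain ⟨s, hs⟩ := (IsPGroup.iff_orderOf.1 hPK) (QuotientGroup.mk τ)
  have hτn₁ : τ ^ p ^ s ∈ K := by
    rw [← QuotientGroup.eq_one_iff, QuotientGroup.mk_pow, ← hs]; exact pow_orderOf_eq_one _
  -- the Kummer character of level `p^m`, `m = s + n₀`
  letI : Field (absIntegers 𝒪[F] F ⧸ absMaximalIdeal F) := Ideal.Quotient.field _
  obtain ⟨ϖ, hϖ⟩ := IsDiscreteValuationRing.exists_irreducible 𝒪[F]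
  have hd : 0 < p ^ (s + n₀) := pow_pos hp.pos _
  have hpd : ¬ ringChar 𝓀[F] ∣ p ^ (s + n₀) := fun h =>
    hℓ ((Nat.prime_dvd_prime_iff_eq (ringChar_residueField_prime (F := F)) hp).mp
      ((ringChar_residueField_prime (F := F)).dvd_of_dvd_pow h))
  set θ := kummerCharacter F hd hϖ.ne_zero (RingHom.id (absIntegers 𝒪[F] F ⧸ absMaximalIdeal F))
    with hθdef
  -- `ker θ` is open: it contains the open stabiliser of the chosen root `zr`
  set zr : AlgebraicClosure F := (kummerRoot F hd ϖ : AlgebraicClosure F) with hzrdef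
  have hzi : IsIntegral F zr := IsIntegral.of_pow hd (by
    rw [hzrdef, coe_kummerRoot_pow F hd ϖ, IsScalarTower.algebraMap_apply 𝒪[F] F (AlgebraicClosure F)]
    exact isIntegral_algebraMap)
  haveI : FiniteDimensional F F⟮zr⟯ := IntermediateField.adjoin.finiteDimensional hzi
  have hkerOpen : IsOpen (θ.ker : Set ↥(absInertia F)) := by
    refine Subgroup.isOpen_of_mem_nhds (g := 1) _ (mem_nhds_iff.2
      ⟨Subtype.val ⁻¹' {γ | absoluteGaloisGroup.toAlgEquiv F γ ∈ F⟮zr⟯.fixingSubgroup}, fun σ hσ => ?_,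
        (IntermediateField.fixingSubgroup_isOpen F⟮zr⟯).preimage continuous_subtype_val, ?_⟩)
    · refine MonoidHom.mem_ker.mpr (kummerCharacter_eq_one_of_smul_eq hd hϖ.ne_zero _ σ ?_)
      rw [absoluteGaloisGroup.smul_def]
      exact (IntermediateField.mem_fixingSubgroup_iff _ _).mp hσ zr
        (IntermediateField.mem_adjoin_simple_self F zr)
    · change absoluteGaloisGroup.toAlgEquiv F ((1 : ↥(absInertia F)) : absoluteGaloisGroup F) ∈
        F⟮zr⟯.fixingSubgroup
      rw [OneMemClass.coe_one, map_one]; exact Subgroup.one_mem _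
  -- the subgroup `H = K ∩ ker θ`
  let H : Subgroup ↥(absInertia F) := K ⊓ θ.ker
  have hHmem : ∀ g, g ∈ H ↔ g ∈ K ∧ θ g = 1 := fun g => by
    change g ∈ K ⊓ θ.ker ↔ _
    rw [Subgroup.mem_inf, MonoidHom.mem_ker]
  haveI hHn : H.Normal := ⟨fun g hg σ => by
    rw [hHmem] at hg ⊢
    exact ⟨hKn.conj_mem g hg.1 σ, by rw [map_mul, map_mul, hg.2, mul_one, ← map_mul, mul_inv_cancel, map_one]⟩⟩
  have hHo : IsOpen (H : Set ↥(absInertia F)) := hKo.inter hkerOpen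
  have hHK : H ≤ K := inf_le_left
  -- `I_F / H` is a finite `p`-group generated by `τ̄`
  haveI : DiscreteTopology (↥(absInertia F) ⧸ H) := QuotientGroup.discreteTopology hHo
  haveI : Finite (↥(absInertia F) ⧸ H) := Subgroup.quotient_finite_of_isOpen H hHo
  have hPH : IsPGroup p (↥(absInertia F) ⧸ H) := fun q => by
    obtain ⟨g, rfl⟩ := QuotientGroup.mk_surjective q
    obtain ⟨k, hk⟩ := hKpow g
    refine ⟨k + (s + n₀), ?_⟩
    rw [← QuotientGroup.mk_pow, QuotientGroup.eq_one_iff, hHmem]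
    refine ⟨by rw [pow_add, pow_mul]; exact K.pow_mem hk _, ?_⟩
    rw [map_pow, pow_add, mul_comm, pow_mul, kummerCharacter_pow_eq_one, one_pow]
  have hgen : ∀ q : ↥(absInertia F) ⧸ H, ∃ i : ℕ, q = (QuotientGroup.mk τ : ↥(absInertia F) ⧸ H) ^ i := by
    intro q
    have hrange := hτ (↥(absInertia F) ⧸ H) hPH (QuotientGroup.mk' H)
      (by exact QuotientGroup.continuous_mk)
    have hq : q ∈ Subgroup.zpowers (QuotientGroup.mk' H τ) := by
      rw [← hrange, QuotientGroup.range_mk']; exact Subgroup.mem_top q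
    rw [← (isOfFinOrder_of_finite _).mem_powers_iff_mem_zpowers, Submonoid.mem_powers_iff] at hq
    obtain ⟨i, hi⟩ := hq
    exact ⟨i, hi.symm⟩
  set P := orderOf (QuotientGroup.mk τ : ↥(absInertia F) ⧸ H) with hPdef
  have hτP : τ ^ P ∈ H := by
    rw [← QuotientGroup.eq_one_iff, QuotientGroup.mk_pow]; exact pow_orderOf_eq_one _
  -- `p^m ∣ P`: `θ` takes a primitive `p^m`-th root of unity, necessarily at a power of `τ` mod `H`
  have hmP : p ^ (s + n₀) ∣ P := by
    obtain ⟨σ₁, hσ₁⟩ := exists_isPrimitiveRoot_kummerCharacter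
      (RingHom.id (absIntegers 𝒪[F] F ⧸ absMaximalIdeal F)) hd hpd hϖ
    obtain ⟨i, hi⟩ := hgen (QuotientGroup.mk σ₁)
    have hmem : (τ ^ i)⁻¹ * σ₁ ∈ H := by
      rw [← QuotientGroup.eq, QuotientGroup.mk_pow]; exact hi.symm
    have hθσ₁ : θ σ₁ = θ τ ^ i := by
      have h := ((hHmem _).1 hmem).2
      rw [map_mul, map_inv, map_pow, inv_mul_eq_one] at h
      exact h.symm
    have h1 : orderOf (θ τ) ∣ P :=
      orderOf_dvd_of_pow_eq_one (by rw [← map_pow]; exact ((hHmem _).1 hτP).2)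
    have h2 : p ^ (s + n₀) ∣ orderOf (θ τ) := by
      rw [hσ₁.eq_orderOf, hθσ₁]; exact orderOf_pow_dvd i
    exact h2.trans h1
  -- `P = p^j` with `j ≥ m`
  obtain ⟨j, hj⟩ := (IsPGroup.iff_orderOf.1 hPH) (QuotientGroup.mk τ)
  rw [← hPdef] at hj
  have hmj : s + n₀ ≤ j := (Nat.pow_dvd_pow_iff_le_right hp.one_lt).1 (by rw [← hj]; exact hmP)
  -- the period sum vanishes: `S(P) = p^{j-s} • S(p^s) = 0`
  have hN : geomSum (X := X) τ a P = 0 := by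
    have hP' : P = p ^ s * p ^ (j - s) := by rw [hj, ← pow_add]; congr 1; omega
    have hle : n₀ ≤ j - s := by omega
    rw [hP', geomSum_mul_eq_smul_of_forall (X := X) τ a (fun i => hKS _ hτn₁ i) (p ^ (j - s)),
      ← Nat.add_sub_cancel' hle, pow_add, mul_comm, mul_smul,
      show p ^ n₀ • geomSum (X := X) τ a (p ^ s) = 0 from nsmul_geomSum_eq_zero (X := X) τ a hn₀ _,
      smul_zero]
  -- `H` fixes the geometric sums; the geometric cocycle
  have hHS : ∀ h ∈ H, ∀ i, X.ρ h (geomSum (X := X) τ a i) = geomSum (X := X) τ a i :=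
    fun h hh i => hKS h (hHK hh) i
  obtain ⟨z, hz⟩ := exists_contOneCocycles_apply_eq_of_cyclic (X := X) τ a H hgen hHo hHS hN
  exact ⟨z, hz⟩

/-- **`H¹(I_F, A) ≃ A ⧸ (ρ τ − 1)A` by evaluation at a tame `p`-generator** (`H¹` of the pro-`p` tame
quotient `ℤ_p(1) = ⟨τ⟩` is the module of coinvariants). Let `F` be a non-archimedean local field with
residue characteristic `≠ p`, `τ ∈ I_F` a tame `p`-generator (every continuous homomorphism of `I_F`
into a discrete `p`-group has image `⟨f τ⟩`; `exists_forall_continuousCohomology_absInertia_equiv_eval`),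
and `ρ : Γ_F → Aut_{ℤ_p}(A)` continuous on a discrete `p`-primary `A` with finite `A[p^k]` on which every
`σ ∈ I_F` acts with pointwise `p`-power order (e.g. unipotently: the Tate curve). Then
`[z] ↦ z(τ) mod (ρ τ − 1)A` is a `ℤ_p`-linear bijection `H¹_cont(I_F, A) ≃ A ⧸ (ρ τ − 1)A`
(well defined: a coboundary `σ ↦ σv − v` has value `(ρ τ − 1)v` at `τ`). Greenberg–Vatsal: "`I_ℓ/J_ℓ ≅ ℤ_p(1)`
… if `ε_ℓ` is a topological generator, `H¹(Ī_ℓ, A_{J_ℓ}) = H¹(Ī_ℓ, A_{J_ℓ}/(ε_ℓ − 1)A_{J_ℓ})`";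
Serre: `H¹(Ẑ, A) = A/(F − 1)A`.
[cite: GreenbergVatsal2000, §2, proof of Prop. (2.4) (arXiv p. 22)]
[cite: SerreLocalFields1979, XIII §1 Prop. 1] -/
theorem exists_continuousCohomology_absInertia_equiv_coinvariants
    (ρ : ContinuousRep (absoluteGaloisGroup F) ℤ_[p] A) (hℓ : ringChar 𝓀[F] ≠ p)
    (hA : ∀ a : A, ∃ k : ℕ, p ^ k • a = 0) (hfin : ∀ k : ℕ, Set.Finite {a : A | p ^ k • a = 0})
    (hP : ∀ σ ∈ absInertia F, ∀ a : A, ∃ k : ℕ, ((ρ σ) ^ p ^ k) a = a)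
    {τ : ↥(absInertia F)}
    (hτ : ∀ (B : Type u) [Group B] [TopologicalSpace B] [DiscreteTopology B], IsPGroup p B →
        ∀ f : ↥(absInertia F) →* B, Continuous f → f.range = Subgroup.zpowers (f τ)) :
    ∃ e : continuousCohomology 1 (subgroupRep ρ.toTopRep (absInertia F)) ≃ₗ[ℤ_[p]]
        (A ⧸ LinearMap.range (ρ (τ : absoluteGaloisGroup F) - 1)),
      ∀ z, e (oneCocycleClass _ z) = Submodule.Quotient.mk (z.1 τ) := by
  set X := subgroupRep ρ.toTopRep (absInertia F) with hXdef
  let ev : contOneCocycles X →ₗ[ℤ_[p]] A ⧸ LinearMap.range (ρ (τ : absoluteGaloisGroup F) - 1) :=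
    { toFun := fun z => Submodule.Quotient.mk (z.1 τ)
      map_add' := fun _ _ => rfl
      map_smul' := fun _ _ => rfl }
  have hev_apply : ∀ z, ev z = Submodule.Quotient.mk (z.1 τ) := fun _ => rfl
  have hev : ∀ f, oneCocycleClass X f = 0 → ev f = 0 := fun f hf => by
    obtain ⟨v, hv⟩ := (oneCocycleClass_eq_zero_iff X f).1 hf
    rw [hev_apply, Submodule.Quotient.mk_eq_zero, hv τ]
    exact ⟨v, rfl⟩
  have he₀ : ∀ z, liftH1ₗ X ev hev (oneCocycleClass X z) = Submodule.Quotient.mk (z.1 τ) := fun z =>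
    liftH1ₗ_oneCocycleClass X ev hev z
  have hbij : Function.Bijective (liftH1ₗ X ev hev) := by
    constructor
    · rw [injective_iff_map_eq_zero]
      intro c hc
      obtain ⟨z, rfl⟩ := oneCocycleClass_surjective X c
      rw [he₀, Submodule.Quotient.mk_eq_zero] at hc
      exact oneCocycleClass_eq_zero_of_apply_mem_range F ρ hA hfin hP hτ z hc
    · intro y
      obtain ⟨a, rfl⟩ := Submodule.Quotient.mk_surjective _ y
      obtain ⟨z, hz⟩ := exists_contOneCocycles_absInertia_apply_eq F ρ hℓ hA hfin hP hτ a
      exact ⟨oneCocycleClass X z, by rw [he₀, hz]⟩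
  exact ⟨LinearEquiv.ofBijective _ hbij, fun z => by rw [LinearEquiv.ofBijective_apply]; exact he₀ z⟩

/-- **One tame `p`-generator for everything** (packaged): for `p ≠` residue characteristic there is
`τ ∈ I_F` such that (1) every continuous homomorphism of `I_F` into a discrete `p`-group has image `⟨f τ⟩`;
(2) for every UNRAMIFIED discrete `p`-primary `ℤ_p[Γ_F]`-module `A`, `[z] ↦ z(τ)` is a `ℤ_p`-linear bijection
`H¹_cont(I_F, A) ≃ A`; (3) for every discrete `p`-primary `A` with finite `A[p^k]` on which `I_F` acts with
pointwise `p`-power order, `[z] ↦ z(τ)` is a `ℤ_p`-linear bijection `H¹_cont(I_F, A) ≃ A ⧸ (ρ τ − 1)A`.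
[cite: GreenbergVatsal2000, §2, proof of Prop. (2.4) (arXiv p. 22)]
[cite: SerreInventiones1972, §1.3 Prop. 1 and §1.7 Prop. 5] [cite: SerreLocalFields1979, XIII §1 Prop. 1] -/
theorem exists_tame_generator_continuousCohomology_absInertia (hℓ : ringChar 𝓀[F] ≠ p) :
    ∃ τ : ↥(absInertia F),
      (∀ (B : Type u) [Group B] [TopologicalSpace B] [DiscreteTopology B], IsPGroup p B →
        ∀ f : ↥(absInertia F) →* B, Continuous f → f.range = Subgroup.zpowers (f τ)) ∧
      (∀ {A : Type u} [AddCommGroup A] [Module ℤ_[p] A] [TopologicalSpace A]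
        [DiscreteTopology A] [ContinuousSMul ℤ_[p] A]
        (ρ : ContinuousRep (absoluteGaloisGroup F) ℤ_[p] A),
        (∀ a : A, ∃ k : ℕ, p ^ k • a = 0) → (∀ σ ∈ absInertia F, ∀ a : A, ρ σ a = a) →
        ∃ e : continuousCohomology 1 (subgroupRep ρ.toTopRep (absInertia F)) ≃ₗ[ℤ_[p]] A,
          ∀ z, e (oneCocycleClass _ z) = z.1 τ) ∧
      ∀ {A : Type u} [AddCommGroup A] [Module ℤ_[p] A] [TopologicalSpace A]
        [DiscreteTopology A] [ContinuousSMul ℤ_[p] A]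
        (ρ : ContinuousRep (absoluteGaloisGroup F) ℤ_[p] A),
        (∀ a : A, ∃ k : ℕ, p ^ k • a = 0) → (∀ k : ℕ, Set.Finite {a : A | p ^ k • a = 0}) →
        (∀ σ ∈ absInertia F, ∀ a : A, ∃ k : ℕ, ((ρ σ) ^ p ^ k) a = a) →
        ∃ e : continuousCohomology 1 (subgroupRep ρ.toTopRep (absInertia F)) ≃ₗ[ℤ_[p]]
            (A ⧸ LinearMap.range (ρ (τ : absoluteGaloisGroup F) - 1)),
          ∀ z, e (oneCocycleClass _ z) = Submodule.Quotient.mk (z.1 τ) := by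
  obtain ⟨τ, hgen, hunr⟩ := exists_forall_continuousCohomology_absInertia_equiv_eval F (p := p) hℓ
  exact ⟨τ, hgen, hunr, fun ρ hA hfin hP =>
    exists_continuousCohomology_absInertia_equiv_coinvariants F ρ hℓ hA hfin hP hgen⟩

end Coinvariants

/-! ### The Frobenius on the `τ`-coinvariants: `q • ē(φ·c) = ρ(φ) ē(c)` -/

section Frobenius

universe u

variable (F : Type u) [Field F] [ValuativeRel F] [TopologicalSpace F] [IsNonarchimedeanLocalField F]
variable {p : ℕ} [Fact p.Prime]
variable {A : Type u} [AddCommGroup A] [Module ℤ_[p] A] [TopologicalSpace A] [DiscreteTopology A]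
  [ContinuousSMul ℤ_[p] A]

open Literature.NumberTheory.EllipticCurves (subgroupConj subgroupConj_apply_coe)

omit [TopologicalSpace A] [DiscreteTopology A] [ContinuousSMul ℤ_[p] A] in
/-- Telescoping: `fⁱ a − a = Σ_{j<i} (f − 1) fʲ a ∈ (f − 1)A`. [folklore] -/
private theorem pow_apply_sub_mem_range_sub_one (f : A →ₗ[ℤ_[p]] A) (a : A) (i : ℕ) :
    (f ^ i) a - a ∈ LinearMap.range (f - 1) := by
  induction i with
  | zero => rw [pow_zero, Module.End.one_apply, sub_self]; exact zero_mem _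
  | succ i ih =>
    have h : (f ^ (i + 1)) a - a = (f - 1) ((f ^ i) a) + ((f ^ i) a - a) := by
      rw [pow_succ', Module.End.mul_apply, LinearMap.sub_apply, Module.End.one_apply]; abel
    rw [h]
    exact add_mem (LinearMap.mem_range_self _ _) ih

/-- A finite abelian group killed by `p ^ k`, `p ≠ ℓ` primes, has order prime to `ℓ` (Cauchy). [folklore] -/
private theorem natCard_coprime_of_prime_pow_nsmul_eq_zero' {B : Type*} [AddCommGroup B] [Finite B]
    {ℓ : ℕ} (hℓ : ℓ.Prime) (hpℓ : ℓ ≠ p) {k : ℕ} (hB : ∀ b : B, p ^ k • b = 0) :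
    (Nat.card B).Coprime ℓ := by
  rw [Nat.Coprime, Nat.gcd_comm]
  refine Nat.coprime_of_dvd fun r hr hrℓ hrB => ?_
  have hr' : r = ℓ := (Nat.prime_dvd_prime_iff_eq hr hℓ).mp hrℓ
  subst hr'
  haveI : Fact r.Prime := ⟨hr⟩
  obtain ⟨b, hb⟩ := exists_prime_addOrderOf_dvd_card' (G := B) r hrB
  have hdvd : r ∣ p ^ k := by rw [← hb]; exact addOrderOf_dvd_of_nsmul_eq_zero (hB b)
  exact hpℓ ((Nat.prime_dvd_prime_iff_eq hr (Fact.out : p.Prime)).mp (hr.dvd_of_dvd_pow hdvd))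

omit [Fact p.Prime] in
/-- In a quotient of `I_F` by an open normal subgroup which is a `p`-group, every element is a power of
the image of a tame `p`-generator `τ`. [folklore] -/
private theorem exists_eq_mk_pow {τ : ↥(absInertia F)}
    (hτ : ∀ (B : Type u) [Group B] [TopologicalSpace B] [DiscreteTopology B], IsPGroup p B →
        ∀ f : ↥(absInertia F) →* B, Continuous f → f.range = Subgroup.zpowers (f τ))
    (H : Subgroup ↥(absInertia F)) [H.Normal] (hHo : IsOpen (H : Set ↥(absInertia F)))
    (hPH : IsPGroup p (↥(absInertia F) ⧸ H)) (q : ↥(absInertia F) ⧸ H) :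
    ∃ i : ℕ, q = (QuotientGroup.mk τ : ↥(absInertia F) ⧸ H) ^ i := by
  haveI : CompactSpace (absoluteGaloisGroup F) := absoluteGaloisGroup_compactSpace F
  haveI : CompactSpace (absInertia F) :=
    isCompact_iff_compactSpace.mp (isClosed_absInertia_holds F).isCompact
  haveI : DiscreteTopology (↥(absInertia F) ⧸ H) := QuotientGroup.discreteTopology hHo
  haveI : Finite (↥(absInertia F) ⧸ H) := Subgroup.quotient_finite_of_isOpen H hHo
  have hrange := hτ (↥(absInertia F) ⧸ H) hPH (QuotientGroup.mk' H) (by exact QuotientGroup.continuous_mk)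
  have hq : q ∈ Subgroup.zpowers (QuotientGroup.mk' H τ) := by
    rw [← hrange, QuotientGroup.range_mk']; exact Subgroup.mem_top q
  rw [← (isOfFinOrder_of_finite _).mem_powers_iff_mem_zpowers, Submonoid.mem_powers_iff] at hq
  obtain ⟨i, hi⟩ := hq
  exact ⟨i, hi.symm⟩

omit [ContinuousSMul ℤ_[p] A] in
/-- **`I_F` acts trivially on the `τ`-coinvariants: `ρ(g)a − a ∈ (ρ τ − 1)A` for every `g ∈ I_F`.**
(For `a ∈ A[pⁿ]` and `K = Fix(A[pⁿ])`, the finite `p`-group `I_F/K` is cyclic on `τ̄`, so `g ∈ τⁱK` and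
`ρ(g)a − a = (ρ(τ)ⁱ − 1)a = Σ_{j<i} (ρ τ − 1)ρ(τ)ʲ a`.) With `range_sub_one_le_comap` this makes
`A ⧸ (ρ τ − 1)A` a `Γ_F/I_F`-module — the module "`A_{I_ℓ}`-coinvariants … `/(ε_ℓ − 1)`" of Greenberg–Vatsal.
[cite: GreenbergVatsal2000, §2, proof of Prop. (2.4) (arXiv p. 22)] -/
theorem apply_sub_mem_range_sub_one (ρ : ContinuousRep (absoluteGaloisGroup F) ℤ_[p] A)
    (hA : ∀ a : A, ∃ k : ℕ, p ^ k • a = 0) (hfin : ∀ k : ℕ, Set.Finite {a : A | p ^ k • a = 0})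
    (hP : ∀ σ ∈ absInertia F, ∀ a : A, ∃ k : ℕ, ((ρ σ) ^ p ^ k) a = a)
    {τ : ↥(absInertia F)}
    (hτ : ∀ (B : Type u) [Group B] [TopologicalSpace B] [DiscreteTopology B], IsPGroup p B →
        ∀ f : ↥(absInertia F) →* B, Continuous f → f.range = Subgroup.zpowers (f τ))
    {g : absoluteGaloisGroup F} (hg : g ∈ absInertia F) (a : A) :
    ρ g a - a ∈ LinearMap.range (ρ (τ : absoluteGaloisGroup F) - 1) := by
  obtain ⟨n, hn⟩ := hA a
  obtain ⟨K, hKn, hKo, hKfix, hKpow⟩ := exists_openNormal_fixing F ρ hfin hP n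
  haveI := hKn
  have hPK : IsPGroup p (↥(absInertia F) ⧸ K) := fun q => by
    obtain ⟨x, rfl⟩ := QuotientGroup.mk_surjective q
    obtain ⟨k, hk⟩ := hKpow x
    exact ⟨k, by rw [← QuotientGroup.mk_pow, QuotientGroup.eq_one_iff]; exact hk⟩
  obtain ⟨i, hi⟩ := exists_eq_mk_pow F hτ K hKo hPK (QuotientGroup.mk ⟨g, hg⟩)
  have hmem : (τ ^ i)⁻¹ * ⟨g, hg⟩ ∈ K := by
    rw [← QuotientGroup.eq, QuotientGroup.mk_pow]; exact hi.symm
  have h := hKfix _ hmem a hn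
  have hga : ρ g a = ρ ((τ ^ i : ↥(absInertia F)) : absoluteGaloisGroup F) a := by
    have h2 := congrArg (ρ ((τ ^ i : ↥(absInertia F)) : absoluteGaloisGroup F)) h
    rw [← Module.End.mul_apply, ← map_mul, ← Subgroup.coe_mul, mul_inv_cancel_left] at h2
    exact h2
  rw [hga, Subgroup.coe_pow, map_pow]
  exact pow_apply_sub_mem_range_sub_one _ a i

omit [ContinuousSMul ℤ_[p] A] in
/-- **`(ρ τ − 1)A` is `Γ_F`-stable**: `ρ(γ)(ρ τ − 1)v = (ρ(γτγ⁻¹) − 1)ρ(γ)v ∈ (ρ τ − 1)A` since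
`γτγ⁻¹ ∈ I_F` acts trivially on the `τ`-coinvariants (`apply_sub_mem_range_sub_one`); so `ρ(γ)` induces
an endomorphism `Submodule.mapQ` of `A ⧸ (ρ τ − 1)A`.
[cite: GreenbergVatsal2000, §2, proof of Prop. (2.4) (arXiv p. 22)] -/
theorem range_sub_one_le_comap (ρ : ContinuousRep (absoluteGaloisGroup F) ℤ_[p] A)
    (hA : ∀ a : A, ∃ k : ℕ, p ^ k • a = 0) (hfin : ∀ k : ℕ, Set.Finite {a : A | p ^ k • a = 0})
    (hP : ∀ σ ∈ absInertia F, ∀ a : A, ∃ k : ℕ, ((ρ σ) ^ p ^ k) a = a)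
    {τ : ↥(absInertia F)}
    (hτ : ∀ (B : Type u) [Group B] [TopologicalSpace B] [DiscreteTopology B], IsPGroup p B →
        ∀ f : ↥(absInertia F) →* B, Continuous f → f.range = Subgroup.zpowers (f τ))
    (γ : absoluteGaloisGroup F) :
    LinearMap.range (ρ (τ : absoluteGaloisGroup F) - 1) ≤
      (LinearMap.range (ρ (τ : absoluteGaloisGroup F) - 1)).comap (ρ γ) := by
  rintro _ ⟨v, rfl⟩
  rw [Submodule.mem_comap, LinearMap.sub_apply, Module.End.one_apply, map_sub]
  have hconj : γ * (τ : absoluteGaloisGroup F) * γ⁻¹ ∈ absInertia F :=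
    (inferInstance : (absInertia F).Normal).conj_mem _ τ.2 γ
  have hγτ : ρ γ (ρ (τ : absoluteGaloisGroup F) v) = ρ (γ * τ * γ⁻¹) (ρ γ v) := by
    rw [← Module.End.mul_apply, ← map_mul, ← Module.End.mul_apply, ← map_mul, mul_assoc _ γ⁻¹ γ,
      inv_mul_cancel, mul_one]
  rw [hγτ]
  exact apply_sub_mem_range_sub_one F ρ hA hfin hP hτ hconj (ρ γ v)

omit [ContinuousSMul ℤ_[p] A] in
/-- **The `τ`-coinvariants are the `I_F`-coinvariants**: `(ρ τ − 1)A` is the `ℤ_p`-span of all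
`ρ(σ)a − a`, `σ ∈ I_F`, `a ∈ A` (`⊇` is `apply_sub_mem_range_sub_one`). So `A ⧸ (ρ τ − 1)A = A_{I_F}`, the
module of inertia coinvariants ("`A_{I_ℓ}`" of Greenberg–Vatsal), independently of the tame `p`-generator `τ`.
[cite: GreenbergVatsal2000, §2, proof of Prop. (2.4) (arXiv p. 22)] -/
theorem range_sub_one_eq_span (ρ : ContinuousRep (absoluteGaloisGroup F) ℤ_[p] A)
    (hA : ∀ a : A, ∃ k : ℕ, p ^ k • a = 0) (hfin : ∀ k : ℕ, Set.Finite {a : A | p ^ k • a = 0})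
    (hP : ∀ σ ∈ absInertia F, ∀ a : A, ∃ k : ℕ, ((ρ σ) ^ p ^ k) a = a)
    {τ : ↥(absInertia F)}
    (hτ : ∀ (B : Type u) [Group B] [TopologicalSpace B] [DiscreteTopology B], IsPGroup p B →
        ∀ f : ↥(absInertia F) →* B, Continuous f → f.range = Subgroup.zpowers (f τ)) :
    LinearMap.range (ρ (τ : absoluteGaloisGroup F) - 1) =
      Submodule.span ℤ_[p] {x : A | ∃ σ ∈ absInertia F, ∃ a : A, x = ρ σ a - a} := by
  apply le_antisymm
  · rintro _ ⟨v, rfl⟩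
    exact Submodule.subset_span ⟨τ, τ.2, v, rfl⟩
  · rw [Submodule.span_le]
    rintro _ ⟨σ, hσ, a, rfl⟩
    exact apply_sub_mem_range_sub_one F ρ hA hfin hP hτ hσ a

/-- **Frobenius on `H¹(I_F, A) ≃ A ⧸ (ρ τ − 1)A`: `q • ē(φ·c) = ρ(φ) ē(c)`.** Under the coinvariant
evaluation bijection `ē [z] = z(τ) mod (ρ τ − 1)A` (`exists_continuousCohomology_absInertia_equiv_coinvariants`)
the conjugation action of a Frobenius `φ` (`conjMap`: `(φ·z)(σ) = ρ(φ) z(φ⁻¹σφ)`) satisfies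
`q • ē(φ·c) = ρ̄(φ) ē(c)`, `ρ̄(φ) = Submodule.mapQ` the endomorphism induced by `ρ(φ)` — i.e.
"`H¹(Ī_ℓ, A) ≅ A_{τ}(−1)` equivariantly for `Gal(F^nr/F)`". (The map `σ ↦ z(σ) mod (ρ τ − 1)A` is a
continuous HOMOMORPHISM of `I_F` into a finite `p`-group, `I_F` acting trivially on the coinvariants, and
conjugation by `φ` multiplies tame homomorphisms by `q`, Serre §1.8 Prop. 6 /
`apply_conj_eq_pow_nsmul_of_isFrobPow`.)
[cite: GreenbergVatsal2000, §2, proof of Prop. (2.4) (arXiv p. 22)] [cite: SerreInventiones1972, §1.8 Prop. 6] -/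
theorem residueFieldCard_nsmul_equiv_conjMap_coinvariants
    (ρ : ContinuousRep (absoluteGaloisGroup F) ℤ_[p] A) (hℓ : ringChar 𝓀[F] ≠ p)
    (hA : ∀ a : A, ∃ k : ℕ, p ^ k • a = 0) (hfin : ∀ k : ℕ, Set.Finite {a : A | p ^ k • a = 0})
    (hP : ∀ σ ∈ absInertia F, ∀ a : A, ∃ k : ℕ, ((ρ σ) ^ p ^ k) a = a)
    {τ : ↥(absInertia F)}
    (hτ : ∀ (B : Type u) [Group B] [TopologicalSpace B] [DiscreteTopology B], IsPGroup p B →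
        ∀ f : ↥(absInertia F) →* B, Continuous f → f.range = Subgroup.zpowers (f τ))
    {φ : absoluteGaloisGroup F} (hφ : IsFrobPow φ 1)
    (e : continuousCohomology 1 (subgroupRep ρ.toTopRep (absInertia F)) ≃ₗ[ℤ_[p]]
        (A ⧸ LinearMap.range (ρ (τ : absoluteGaloisGroup F) - 1)))
    (he : ∀ z, e (oneCocycleClass _ z) = Submodule.Quotient.mk (z.1 τ))
    (c : continuousCohomology 1 (subgroupRep ρ.toTopRep (absInertia F))) :
    residueFieldCard F • e (conjMap ρ.toTopRep (absInertia F) φ 1 c) =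
      Submodule.mapQ _ _ (ρ φ) (range_sub_one_le_comap F ρ hA hfin hP hτ φ) (e c) := by
  classical
  haveI : CompactSpace (absoluteGaloisGroup F) := absoluteGaloisGroup_compactSpace F
  haveI : CompactSpace (absInertia F) :=
    isCompact_iff_compactSpace.mp (isClosed_absInertia_holds F).isCompact
  obtain ⟨z, rfl⟩ := oneCocycleClass_surjective _ c
  -- the continuous homomorphism `f = mk ∘ z : I_F → B'`, `B'` the (finite) image of `A[pⁿ]` in `A ⧸ Rτ`
  obtain ⟨n, hn⟩ := exists_forall_pow_smul_apply_eq_zero' (A := A) hA (f := fun g => (z.1 g : A))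
    z.1.continuous
  let S : AddSubgroup A := (nsmulAddMonoidHom (p ^ n) : A →+ A).ker
  have hmemS : ∀ a : A, a ∈ S ↔ p ^ n • a = 0 := fun a => by
    rw [AddMonoidHom.mem_ker, nsmulAddMonoidHom_apply]
  haveI : Finite S := by
    haveI : Finite {a : A | p ^ n • a = 0} := (hfin n).to_subtype
    exact Finite.of_equiv {a : A | p ^ n • a = 0} (Equiv.subtypeEquivRight fun a => (hmemS a).symm)
  let π : A →ₗ[ℤ_[p]] A ⧸ LinearMap.range (ρ (τ : absoluteGaloisGroup F) - 1) :=
    (LinearMap.range (ρ (τ : absoluteGaloisGroup F) - 1)).mkQ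
  have hπ : ∀ a, π a = Submodule.Quotient.mk a := fun _ => rfl
  let B' : AddSubgroup (A ⧸ LinearMap.range (ρ (τ : absoluteGaloisGroup F) - 1)) :=
    S.map π.toAddMonoidHom
  have hmemB' : ∀ a ∈ S, π a ∈ B' := fun a ha => AddSubgroup.mem_map_of_mem _ ha
  haveI : Finite B' := by
    refine Finite.of_surjective (fun s : S => (⟨π s, hmemB' s s.2⟩ : B')) fun b => ?_
    obtain ⟨a, ha, hab⟩ := AddSubgroup.mem_map.mp b.2
    exact ⟨⟨a, ha⟩, Subtype.ext hab⟩
  letI : TopologicalSpace B' := ⊥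
  haveI : DiscreteTopology B' := ⟨rfl⟩
  have hB'card : (Nat.card B').Coprime (ringChar 𝓀[F]) := by
    refine natCard_coprime_of_prime_pow_nsmul_eq_zero' (ringChar_residueField_prime (F := F)) hℓ (k := n)
      fun b => Subtype.ext ?_
    obtain ⟨a, ha, hab⟩ := AddSubgroup.mem_map.mp b.2
    rw [AddSubgroupClass.coe_nsmul, ZeroMemClass.coe_zero, ← hab, LinearMap.toAddMonoidHom_coe, ← map_nsmul,
      (hmemS a).mp ha, map_zero]
  let f : absInertia F → B' := fun σ => ⟨π (z.1 σ), hmemB' _ ((hmemS _).mpr (hn σ))⟩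
  have hfval : ∀ σ, ((f σ : B') : A ⧸ LinearMap.range (ρ (τ : absoluteGaloisGroup F) - 1)) =
      Submodule.Quotient.mk (z.1 σ) := fun _ => rfl
  have hf : ∀ x y, f (x * y) = f x + f y := fun x y => Subtype.ext (by
    change π (z.1 (x * y)) = π (z.1 x) + π (z.1 y)
    rw [z.2 x y, map_add, add_right_inj, hπ, hπ, Submodule.Quotient.eq]
    exact apply_sub_mem_range_sub_one F ρ hA hfin hP hτ x.2 _)
  have hfc : Continuous f := by
    have h1 : Continuous fun σ : absInertia F => (⟨z.1 σ, (hmemS _).mpr (hn σ)⟩ : S) :=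
      (z.1.continuous).subtype_mk _
    exact (continuous_of_discreteTopology (f := fun s : S => (⟨π s, hmemB' s s.2⟩ : B'))).comp h1
  -- Serre: `f(φ σ' φ⁻¹) = q • f(σ')` with `σ' = φ⁻¹ τ φ`, i.e. `mk z(τ) = q • mk z(φ⁻¹ τ φ)`
  have hconj : φ * ((subgroupConj (absInertia F) φ τ : absInertia F) : absoluteGaloisGroup F) * φ⁻¹ ∈
      absInertia F := by
    rw [subgroupConj_apply_coe]
    have : φ * (φ⁻¹ * (τ : absoluteGaloisGroup F) * φ) * φ⁻¹ = τ := by group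
    rw [this]; exact τ.2
  have key := apply_conj_eq_pow_nsmul_of_isFrobPow F hB'card f hf hfc hφ
    (subgroupConj (absInertia F) φ τ) hconj
  have hσ : (⟨φ * ((subgroupConj (absInertia F) φ τ : absInertia F) : absoluteGaloisGroup F) * φ⁻¹, hconj⟩ :
      absInertia F) = τ := Subtype.ext (by
    change φ * (φ⁻¹ * (τ : absoluteGaloisGroup F) * φ) * φ⁻¹ = τ; group)
  rw [hσ, pow_one] at key
  have key' := congrArg Subtype.val key
  rw [AddSubgroupClass.coe_nsmul, hfval, hfval] at key'
  -- assemble: `q • mk(ρφ z(σ')) = ρ̄φ (q • mk z(σ')) = ρ̄φ (mk z(τ))`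
  rw [conjMap_oneCocycleClass, he, he, conj_pullback_apply, key', map_nsmul, Submodule.mapQ_apply]
  rfl

end Frobenius

end Literature.NumberTheory.GaloisRepresentations

end
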